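import Summits.NavierStokesRegularity.NavierStokesRegularity.Theorems.ExtremiserTransiencePerFlowLockedTimesLogDensity
import Summits.NavierStokesRegularity.NavierStokesRegularity.Theorems.ExtremiserTransiencePerFlowLowerLockUnconditional
import HarnessLib

/-!
# Route `ExtremiserTransience`, LINE g4-α «per-flow-tangent» (ns-idea-5 g4): the two-sided SCALE LOCK at near-extremal late
# times of a Type-I singular flow is a THEOREM (skeleton v3d, proved part)

`--supports stmt-NavierStokesRegularity-26568` (`TangentExtremalExtraction`).  This file moves the PROVED part of skeleton v3d
(HOME ns-idea-5/lineL/SketchV3d.lean: `upperLock_of_lockedDensity`, `scaleLock_of_upperLock`) into the tree, with unbundled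
hypotheses: for a classical solution on `[0,T) × ℝ³` from rapidly decaying Leray–Hopf data with eventual Type-I rate
`√(T−t)‖u(t)‖_∞ ≤ C√ν`, no smooth extension past `T`, and NO per-flow depletion certificate with exponent `θ < 1`:
* `upperLock_at_nearEfficient_times`: `∃ c₂ ∀ 0 < m < κ⋆ ∀ t₁ < T`, the strictly `m`-efficient times `t ∈ [t₁,T)` with
  `Z(t) ≤ c₂ν(T−t)P(t)` form a non-null set (density bookkeeping: locked times have lower log-density `d₀ > 0`,
  `lockedTimes_logDensity`; efficient times have upper log-density one, `efficientTimes_logDensity_of_not_perFlow`);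
* `scaleLock_at_nearEfficient_times`: with the unconditional lower lock (`lowerLock_at_nearEfficient_times`), `∃ 0 < c₁ ≤ c₂ ∀ ε > 0
  ∀ t₁ < T`, the `(κ⋆−ε)`-efficient times with `c₁ν(T−t)P ≤ Z ≤ c₂ν(T−t)P` form a non-null set.
So the KNSS zoom at those times sees a unit-Reynolds-number, near-extremal slice at ONE SCALE `λ = √(Z/P) ≍ √(ν(T−t))`; the open
content of the line is the extraction/rigidity pair (`stub_extraction_of_lock`, `stub_noExtremalAncientPM`).
HONEST FRAMING: statements about hypothetical Type-I singular flows; nothing about Navier–Stokes regularity or blow-up is proved.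
[folklore]
-/

noncomputable section

open scoped Topology MeasureTheory InnerProductSpace
open Filter Set MeasureTheory

namespace Summit.NavierStokesRegularity.NavierStokesRegularity.Theorems.DepletionLadder.PerFlow
set_option linter.dupNamespace false
set_option linter.style.longLine false

/-- **Upper scale lock at strictly `m`-efficient late times** (for every `m < κ⋆`): a Type-I singular flow failing the per-flow
depletion conclusion has, past every onset `t₁`, a NON-NULL set of strictly `m`-efficient times at which `Z ≤ c₂ ν (T−t) P`.
(S1 `lockedTimes_logDensity` + the full upper log-density of efficient times `efficientTimes_logDensity_of_not_perFlow`.) [folklore] -/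
theorem upperLock_at_nearEfficient_times {C ν T : ℝ} (hC : 0 < C) (hν : 0 < ν) (hT : 0 < T)
    {u : ℝ → EuclideanSpace ℝ (Fin 3) → EuclideanSpace ℝ (Fin 3)} {p : ℝ → EuclideanSpace ℝ (Fin 3) → ℝ}
    (hsol : Literature.Analysis.FluidPDE.IsClassicalNSSolutionOn (Set.Ico 0 T) ν 0 u p)
    (hLH : Literature.Analysis.FluidPDE.IsLerayHopfOn T ν 0 (u 0) u)
    (hdec : Literature.Analysis.FluidPDE.HasRapidSpatialDecay (u 0))
    (hrate : ∀ᶠ t in 𝓝[<] T, ∀ x, Real.sqrt (T - t) * ‖u t x‖ ≤ C * Real.sqrt ν)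
    (hext : ¬ Literature.Analysis.FluidPDE.HasSmoothExtensionPast ν 0 u T)
    (hnot : ¬ (∃ θ : ℝ, 0 ≤ θ ∧ θ < 1 ∧ ∀ κ : ℝ, (∀ (v : EuclideanSpace ℝ (Fin 3) → EuclideanSpace ℝ (Fin 3)) (M B : ℝ), ContDiff ℝ (⊤ : ℕ∞) v → Literature.Analysis.FluidPDE.VectorCalculus.IsDivFree v → (∀ x, ‖v x‖ ≤ M) → (∀ x, ‖fderiv ℝ v x‖ ≤ B) → (∫⁻ x, ‖iteratedFDeriv ℝ 0 v x‖ₑ ^ 2 < ⊤) → (∫⁻ x, ‖iteratedFDeriv ℝ 1 v x‖ₑ ^ 2 < ⊤) → (∫⁻ x, ‖iteratedFDeriv ℝ 2 v x‖ₑ ^ 2 < ⊤) → |∫ x, ⟪Literature.Analysis.FluidPDE.curl v x, fderiv ℝ v x (Literature.Analysis.FluidPDE.curl v x)⟫_ℝ| ≤ κ * M * Real.sqrt (∫ x, ‖Literature.Analysis.FluidPDE.curl v x‖ ^ 2) * Real.sqrt (∫ x, Literature.Analysis.FluidPDE.frobeniusNormSq (fderiv ℝ (Literature.Analysis.FluidPDE.curl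 v) x))) → ∃ t₁ ∈ Set.Ico 0 T, ∃ (k : ℝ → ℝ) (B : ℝ), Measurable k ∧ (∀ τ, 0 ≤ k τ ∧ k τ ≤ 1) ∧ (∀ t ∈ Set.Ico t₁ T, ∀ M : ℝ, (∀ x, ‖u t x‖ ≤ M) → |∫ x, ⟪Literature.Analysis.FluidPDE.curl (u t) x, fderiv ℝ (u t) x (Literature.Analysis.FluidPDE.curl (u t) x)⟫_ℝ| ≤ k t * M * Real.sqrt (∫ x, ‖Literature.Analysis.FluidPDE.curl (u t) x‖ ^ 2) * Real.sqrt (∫ x, Literature.Analysis.FluidPDE.frobeniusNormSq (fderiv ℝ (Literature.Analysis.FluidPDE.curl (u t)) x))) ∧ (∀ t ∈ Set.Ico t₁ T, ∫ τ in t₁..t, k τ ^ 2 / (T - τ) ≤ (θ * κ) ^ 2 * Real.log ((T - t₁) / (T - t)) + B))) :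
    ∃ c₂ : ℝ, ∀ m : ℝ, 0 < m → m < (sInf {κ : ℝ | (∀ (v : EuclideanSpace ℝ (Fin 3) → EuclideanSpace ℝ (Fin 3)) (M B : ℝ), ContDiff ℝ (⊤ : ℕ∞) v → Literature.Analysis.FluidPDE.VectorCalculus.IsDivFree v → (∀ x, ‖v x‖ ≤ M) → (∀ x, ‖fderiv ℝ v x‖ ≤ B) → (∫⁻ x, ‖iteratedFDeriv ℝ 0 v x‖ₑ ^ 2 < ⊤) → (∫⁻ x, ‖iteratedFDeriv ℝ 1 v x‖ₑ ^ 2 < ⊤) → (∫⁻ x, ‖iteratedFDeriv ℝ 2 v x‖ₑ ^ 2 < ⊤) → |∫ x, ⟪Literature.Analysis.FluidPDE.curl v x, fderiv ℝ v x (Literature.Analysis.FluidPDE.curl v x)⟫_ℝ| ≤ κ * M * Real.sqrt (∫ x, ‖Literature.Analysis.FluidPDE.curl v x‖ ^ 2) * Real.sqrt (∫ x, Literature.Analysis.FluidPDE.frobeniusNormSq (fderiv ℝ (Literature.Analysis.FluidPDE.curl v) x)))}) → ∀ t₁ ∈ Set.Ico 0 T,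
        volume {t : ℝ | t ∈ Set.Ico t₁ T ∧ (∃ M : ℝ, (∀ x, ‖u t x‖ ≤ M) ∧ m * M * Real.sqrt (∫ x, ‖Literature.Analysis.FluidPDE.curl (u t) x‖ ^ 2) * Real.sqrt (∫ x, Literature.Analysis.FluidPDE.frobeniusNormSq (fderiv ℝ (Literature.Analysis.FluidPDE.curl (u t)) x)) < |∫ x, ⟪Literature.Analysis.FluidPDE.curl (u t) x, fderiv ℝ (u t) x (Literature.Analysis.FluidPDE.curl (u t) x)⟫_ℝ|) ∧ (∫ x, ‖Literature.Analysis.FluidPDE.curl (u t) x‖ ^ 2) ≤ c₂ * (ν * (T - t)) * (∫ x, Literature.Analysis.FluidPDE.frobeniusNormSq (fderiv ℝ (Literature.Analysis.FluidPDE.curl (u t)) x))} ≠ 0 := by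
  obtain ⟨c₂, d₀, hd₀, hS⟩ := lockedTimes_logDensity hC hν hT hsol hLH hdec hrate hext
  obtain ⟨k, hkm, hk01, hFW, hkle, heff, hdens⟩ :=
    Summit.NavierStokesRegularity.NavierStokesRegularity.Theorems.DepletionLadder.PerFlow.efficientTimes_logDensity_of_not_perFlow
      hν hT hsol hLH hdec hnot
  refine ⟨c₂, fun m hm hmlt t₁ ht₁ hnull => ?_⟩
  obtain ⟨S, hSmeas, hSsub, c, hSdens⟩ := hS t₁ ht₁
  obtain ⟨t, ht, hEt⟩ := hdens m hmlt (1 - d₀ / 2) (by linarith) (c + 1) t₁ ht₁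
  have hSt := hSdens t ht
  have h1 : t₁ ≤ t := ht.1
  have hTt : 0 < T - t := sub_pos.2 ht.2
  have hlog0 : 0 ≤ Real.log ((T - t₁) / (T - t)) :=
    Real.log_nonneg ((one_le_div hTt).2 (by linarith [ht.1]))
  -- the three indicator densities
  set E : Set ℝ := {s : ℝ | m < k s} with hE
  have hEmeas : MeasurableSet E := measurableSet_lt measurable_const hkm
  have hESmeas : MeasurableSet (E ∩ S) := hEmeas.inter hSmeas
  -- generic facts about `1_A / (T - τ)` on `[t₁, t]`
  have ind_cases : ∀ (A : Set ℝ) (τ : ℝ), A.indicator (fun _ => (1 : ℝ)) τ = 0 ∨ A.indicator (fun _ => (1 : ℝ)) τ = 1 := by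
    intro A τ
    by_cases hτ : τ ∈ A
    · right; simp [hτ]
    · left; simp [hτ]
  have ind_int : ∀ (A : Set ℝ), MeasurableSet A →
      IntervalIntegrable (fun τ => A.indicator (fun _ => (1 : ℝ)) τ / (T - τ)) volume t₁ t := by
    intro A hA
    have hmeasf : Measurable (A.indicator (fun _ => (1 : ℝ))) := measurable_const.indicator hA
    have h01 : ∀ τ, 0 ≤ A.indicator (fun _ => (1 : ℝ)) τ ∧ A.indicator (fun _ => (1 : ℝ)) τ ≤ 1 := fun τ => by
      rcases ind_cases A τ with h | h <;> rw [h] <;> norm_num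
    have h' := Summit.NavierStokesRegularity.NavierStokesRegularity.Theorems.DepletionLadder.intervalIntegrable_coeff_sq_div
      (T := T) hmeasf h01 h1 ht.2
    have hsq : (fun τ => A.indicator (fun _ => (1 : ℝ)) τ ^ 2 / (T - τ)) = fun τ => A.indicator (fun _ => (1 : ℝ)) τ / (T - τ) := by
      funext τ; rcases ind_cases A τ with h | h <;> simp [h]
    rw [← hsq]; exact h'
  have hIone : IntervalIntegrable (fun τ => (1 : ℝ) / (T - τ)) volume t₁ t := by
    refine intervalIntegral.intervalIntegrable_one_div (fun τ hτ => ?_) (continuousOn_const.sub continuousOn_id)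
    rw [Set.uIcc_of_le h1] at hτ
    exact (sub_pos.2 (lt_of_le_of_lt hτ.2 ht.2)).ne'
  have hsub1 : ∫ τ in t₁..t, (1 : ℝ) / (T - τ) = Real.log ((T - t₁) / (T - t)) := by
    have h := intervalIntegral.integral_comp_sub_left (fun x : ℝ => (1 : ℝ) / x) T (a := t₁) (b := t)
    rw [h, integral_one_div_of_pos hTt (sub_pos.2 ht₁.2)]
  -- pointwise: 1_(E∩S) ≥ 1_E + 1_S − 1
  have hpt : ∀ τ ∈ Set.Icc t₁ t,
      E.indicator (fun _ => (1 : ℝ)) τ / (T - τ) + S.indicator (fun _ => (1 : ℝ)) τ / (T - τ) - 1 / (T - τ) ≤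
        (E ∩ S).indicator (fun _ => (1 : ℝ)) τ / (T - τ) := by
    intro τ hτ
    have hTτ : 0 < T - τ := sub_pos.2 (lt_of_le_of_lt hτ.2 ht.2)
    rw [← add_div, ← sub_div]
    refine div_le_div_of_nonneg_right ?_ hTτ.le
    by_cases hτE : τ ∈ E <;> by_cases hτS : τ ∈ S <;> simp [Set.indicator, hτE, hτS]
  have hIlhs : IntervalIntegrable (fun τ => E.indicator (fun _ => (1 : ℝ)) τ / (T - τ) + S.indicator (fun _ => (1 : ℝ)) τ / (T - τ) - 1 / (T - τ)) volume t₁ t :=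
    ((ind_int E hEmeas).add (ind_int S hSmeas)).sub hIone
  have hmono := intervalIntegral.integral_mono_on h1 hIlhs (ind_int (E ∩ S) hESmeas) hpt
  rw [intervalIntegral.integral_sub ((ind_int E hEmeas).add (ind_int S hSmeas)) hIone,
    intervalIntegral.integral_add (ind_int E hEmeas) (ind_int S hSmeas), hsub1] at hmono
  -- the (E ∩ S)-density is positive
  have hpos : 0 < ∫ τ in t₁..t, (E ∩ S).indicator (fun _ => (1 : ℝ)) τ / (T - τ) := by
    have : (1 - d₀ / 2) * Real.log ((T - t₁) / (T - t)) + (c + 1) + (d₀ * Real.log ((T - t₁) / (T - t)) - c)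
        - Real.log ((T - t₁) / (T - t)) = d₀ / 2 * Real.log ((T - t₁) / (T - t)) + 1 := by ring
    nlinarith [hmono, hEt, hSt, this, mul_nonneg hd₀.le hlog0]
  -- but `E ∩ S ⊆` the null set
  have hsubset : E ∩ S ⊆ {t : ℝ | t ∈ Set.Ico t₁ T ∧ (∃ M : ℝ, (∀ x, ‖u t x‖ ≤ M) ∧ m * M * Real.sqrt (∫ x, ‖Literature.Analysis.FluidPDE.curl (u t) x‖ ^ 2) * Real.sqrt (∫ x, Literature.Analysis.FluidPDE.frobeniusNormSq (fderiv ℝ (Literature.Analysis.FluidPDE.curl (u t)) x)) < |∫ x, ⟪Literature.Analysis.FluidPDE.curl (u t) x, fderiv ℝ (u t) x (Literature.Analysis.FluidPDE.curl (u t) x)⟫_ℝ|) ∧ (∫ x, ‖Literature.Analysis.FluidPDE.curl (u t) x‖ ^ 2) ≤ c₂ * (ν * (T - t)) * (∫ x, Literature.Analysis.FluidPDE.frobeniusNormSq (fderiv ℝ (Literature.Analysis.FluidPDE.curl (u t)) x))} := by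
    rintro τ ⟨hτE, hτS⟩
    obtain ⟨hτI, hlock⟩ := hSsub hτS
    exact ⟨hτI, heff τ ⟨ht₁.1.trans hτI.1, hτI.2⟩ m hm.le hτE, hlock⟩
  have hnullES : volume (E ∩ S) = 0 := measure_mono_null hsubset hnull
  have hae : ∀ᵐ τ ∂volume, (E ∩ S).indicator (fun _ => (1 : ℝ)) τ / (T - τ) = 0 := by
    have h2 : ∀ᵐ τ ∂volume, τ ∉ E ∩ S := ae_iff.2 (by simpa only [not_not, Set.setOf_mem_eq] using hnullES)
    filter_upwards [h2] with τ hτ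
    simp [Set.indicator_of_notMem hτ]
  have hzero : ∫ τ in t₁..t, (E ∩ S).indicator (fun _ => (1 : ℝ)) τ / (T - τ) = 0 := by
    rw [intervalIntegral.integral_of_le h1]
    exact integral_eq_zero_of_ae (ae_restrict_of_ae hae)
  rw [hzero] at hpos
  exact lt_irrefl _ hpos

/-- **Two-sided SCALE LOCK at near-extremal late times.**  For a Type-I singular flow failing the per-flow depletion conclusion:
constants `0 < c₁ ≤ c₂` such that for every `ε > 0` and every onset `t₁ < T` the set of times `t ∈ [t₁,T)` at which the slice is
`(κ⋆−ε)`-efficient AND `c₁ ν(T−t) P ≤ Z ≤ c₂ ν(T−t) P` (`λ² = Z/P ≍ ν(T−t)`) is NON-NULL.  Lower half: `lowerLock_at_nearEfficient_times`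
(unconditional); upper half: `upperLock_at_nearEfficient_times`. [folklore] -/
theorem scaleLock_at_nearEfficient_times {C ν T : ℝ} (hC : 0 < C) (hν : 0 < ν) (hT : 0 < T)
    {u : ℝ → EuclideanSpace ℝ (Fin 3) → EuclideanSpace ℝ (Fin 3)} {p : ℝ → EuclideanSpace ℝ (Fin 3) → ℝ}
    (hsol : Literature.Analysis.FluidPDE.IsClassicalNSSolutionOn (Set.Ico 0 T) ν 0 u p)
    (hLH : Literature.Analysis.FluidPDE.IsLerayHopfOn T ν 0 (u 0) u)
    (hdec : Literature.Analysis.FluidPDE.HasRapidSpatialDecay (u 0))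
    (hrate : ∀ᶠ t in 𝓝[<] T, ∀ x, Real.sqrt (T - t) * ‖u t x‖ ≤ C * Real.sqrt ν)
    (hext : ¬ Literature.Analysis.FluidPDE.HasSmoothExtensionPast ν 0 u T)
    (hnot : ¬ (∃ θ : ℝ, 0 ≤ θ ∧ θ < 1 ∧ ∀ κ : ℝ, (∀ (v : EuclideanSpace ℝ (Fin 3) → EuclideanSpace ℝ (Fin 3)) (M B : ℝ), ContDiff ℝ (⊤ : ℕ∞) v → Literature.Analysis.FluidPDE.VectorCalculus.IsDivFree v → (∀ x, ‖v x‖ ≤ M) → (∀ x, ‖fderiv ℝ v x‖ ≤ B) → (∫⁻ x, ‖iteratedFDeriv ℝ 0 v x‖ₑ ^ 2 < ⊤) → (∫⁻ x, ‖iteratedFDeriv ℝ 1 v x‖ₑ ^ 2 < ⊤) → (∫⁻ x, ‖iteratedFDeriv ℝ 2 v x‖ₑ ^ 2 < ⊤) → |∫ x, ⟪Literature.Analysis.FluidPDE.curl v x, fderiv ℝ v x (Literature.Analysis.FluidPDE.curl v x)⟫_ℝ| ≤ κ * M * Real.sqrt (∫ x, ‖Literature.Analysis.FluidPDE.curl v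 x‖ ^ 2) * Real.sqrt (∫ x, Literature.Analysis.FluidPDE.frobeniusNormSq (fderiv ℝ (Literature.Analysis.FluidPDE.curl v) x))) → ∃ t₁ ∈ Set.Ico 0 T, ∃ (k : ℝ → ℝ) (B : ℝ), Measurable k ∧ (∀ τ, 0 ≤ k τ ∧ k τ ≤ 1) ∧ (∀ t ∈ Set.Ico t₁ T, ∀ M : ℝ, (∀ x, ‖u t x‖ ≤ M) → |∫ x, ⟪Literature.Analysis.FluidPDE.curl (u t) x, fderiv ℝ (u t) x (Literature.Analysis.FluidPDE.curl (u t) x)⟫_ℝ| ≤ k t * M * Real.sqrt (∫ x, ‖Literature.Analysis.FluidPDE.curl (u t) x‖ ^ 2) * Real.sqrt (∫ x, Literature.Analysis.FluidPDE.frobeniusNormSq (fderiv ℝ (Literature.Analysis.FluidPDE.curl (u t)) x))) ∧ (∀ t ∈ Set.Ico t₁ T, ∫ τ in t₁..t, k τ ^ 2 / (T - τ) ≤ (θ * κ) ^ 2 * Real.log ((T - t₁) / (T - t)) + B))) :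
    ∃ c₁ c₂ : ℝ, 0 < c₁ ∧ c₁ ≤ c₂ ∧ ∀ ε : ℝ, 0 < ε → ∀ t₁ ∈ Set.Ico 0 T, volume ({t : ℝ | t ∈ Set.Ico t₁ T ∧ c₁ * (ν * (T - t)) * (∫ x, Literature.Analysis.FluidPDE.frobeniusNormSq (fderiv ℝ (Literature.Analysis.FluidPDE.curl (u t)) x)) ≤ (∫ x, ‖Literature.Analysis.FluidPDE.curl (u t) x‖ ^ 2) ∧ (∫ x, ‖Literature.Analysis.FluidPDE.curl (u t) x‖ ^ 2) ≤ c₂ * (ν * (T - t)) * (∫ x, Literature.Analysis.FluidPDE.frobeniusNormSq (fderiv ℝ (Literature.Analysis.FluidPDE.curl (u t)) x)) ∧ (ContDiff ℝ (⊤ : ℕ∞) (u t) ∧ Literature.Analysis.FluidPDE.VectorCalculus.IsDivFree (u t) ∧ (∃ B : ℝ, ∀ x, ‖fderiv ℝ (u t) x‖ ≤ B) ∧ (∫⁻ x, ‖iteratedFDeriv ℝ 1 (u t) x‖ₑ ^ 2 < ⊤) ∧ (∫⁻ x, ‖iteratedFDeriv ℝ 2 (u t) x‖ₑ ^ 2 <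 ⊤) ∧ ∃ M : ℝ, (∀ x, ‖(u t) x‖ ≤ M) ∧ 0 < M * Real.sqrt (∫ x, ‖Literature.Analysis.FluidPDE.curl (u t) x‖ ^ 2) * Real.sqrt (∫ x, Literature.Analysis.FluidPDE.frobeniusNormSq (fderiv ℝ (Literature.Analysis.FluidPDE.curl (u t)) x)) ∧ ((sInf {κ : ℝ | (∀ (v : EuclideanSpace ℝ (Fin 3) → EuclideanSpace ℝ (Fin 3)) (M B : ℝ), ContDiff ℝ (⊤ : ℕ∞) v → Literature.Analysis.FluidPDE.VectorCalculus.IsDivFree v → (∀ x, ‖v x‖ ≤ M) → (∀ x, ‖fderiv ℝ v x‖ ≤ B) → (∫⁻ x, ‖iteratedFDeriv ℝ 0 v x‖ₑ ^ 2 < ⊤) → (∫⁻ x, ‖iteratedFDeriv ℝ 1 v x‖ₑ ^ 2 < ⊤) → (∫⁻ x, ‖iteratedFDeriv ℝ 2 v x‖ₑ ^ 2 < ⊤) → |∫ x, ⟪Literature.Analysis.FluidPDE.curl v x, fderiv ℝ v x (Literature.Analysis.FluidPDE.curl v x)⟫_ℝ| ≤ κ * M * Real.sqrt (∫ x, ‖Literature.Analysis.FluidPDE.curl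 v x‖ ^ 2) * Real.sqrt (∫ x, Literature.Analysis.FluidPDE.frobeniusNormSq (fderiv ℝ (Literature.Analysis.FluidPDE.curl v) x)))}) - ε) * M * Real.sqrt (∫ x, ‖Literature.Analysis.FluidPDE.curl (u t) x‖ ^ 2) * Real.sqrt (∫ x, Literature.Analysis.FluidPDE.frobeniusNormSq (fderiv ℝ (Literature.Analysis.FluidPDE.curl (u t)) x)) ≤ |∫ x, ⟪Literature.Analysis.FluidPDE.curl (u t) x, fderiv ℝ (u t) x (Literature.Analysis.FluidPDE.curl (u t) x)⟫_ℝ|)}) ≠ 0 := by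
  obtain ⟨c₂, hup⟩ := upperLock_at_nearEfficient_times hC hν hT hsol hLH hdec hrate hext hnot
  obtain ⟨C₁, hC₁, hgrad⟩ :=
    Summit.NavierStokesRegularity.NavierStokesRegularity.Theorems.DepletionLadder.PerFlow.gradTypeIRate_of_typeIRate
      hC hν hT hsol hLH hdec hrate
  obtain ⟨c₀, hc₀, hleray⟩ :=
    Summit.NavierStokesRegularity.NavierStokesRegularity.Theorems.DepletionLadder.PerFlow.lerayLowerRate_of_not_extends
      hν hT hsol hLH hdec hext
  obtain ⟨a, haT, hsub⟩ := mem_nhdsLT_iff_exists_Ioo_subset.1 hgrad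
  have haT' : a < T := haT
  have hloc := Summit.NavierStokesRegularity.NavierStokesRegularity.Theorems.EnstrophyBudget.isLocalSolution hν hT hsol hLH hdec
  have hkpos : 0 < (sInf {κ : ℝ | (∀ (v : EuclideanSpace ℝ (Fin 3) → EuclideanSpace ℝ (Fin 3)) (M B : ℝ), ContDiff ℝ (⊤ : ℕ∞) v → Literature.Analysis.FluidPDE.VectorCalculus.IsDivFree v → (∀ x, ‖v x‖ ≤ M) → (∀ x, ‖fderiv ℝ v x‖ ≤ B) → (∫⁻ x, ‖iteratedFDeriv ℝ 0 v x‖ₑ ^ 2 < ⊤) → (∫⁻ x, ‖iteratedFDeriv ℝ 1 v x‖ₑ ^ 2 < ⊤) → (∫⁻ x, ‖iteratedFDeriv ℝ 2 v x‖ₑ ^ 2 < ⊤) → |∫ x, ⟪Literature.Analysis.FluidPDE.curl v x, fderiv ℝ v x (Literature.Analysis.FluidPDE.curl v x)⟫_ℝ| ≤ κ * M * Real.sqrt (∫ x, ‖Literature.Analysis.FluidPDE.curl v x‖ ^ 2) * Real.sqrt (∫ x, Literature.Analysis.FluidPDE.frobeniusNormSq (fderiv ℝ (Literature.Analysis.FluidPDE.curl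 v) x)))}) := lt_trans (by norm_num) Summit.NavierStokesRegularity.NavierStokesRegularity.Theorems.DepletionLadder.sharpDepletion_gt
  set c₁ : ℝ := c₀ ^ 2 / C₁ ^ 2 * ((sInf {κ : ℝ | (∀ (v : EuclideanSpace ℝ (Fin 3) → EuclideanSpace ℝ (Fin 3)) (M B : ℝ), ContDiff ℝ (⊤ : ℕ∞) v → Literature.Analysis.FluidPDE.VectorCalculus.IsDivFree v → (∀ x, ‖v x‖ ≤ M) → (∀ x, ‖fderiv ℝ v x‖ ≤ B) → (∫⁻ x, ‖iteratedFDeriv ℝ 0 v x‖ₑ ^ 2 < ⊤) → (∫⁻ x, ‖iteratedFDeriv ℝ 1 v x‖ₑ ^ 2 < ⊤) → (∫⁻ x, ‖iteratedFDeriv ℝ 2 v x‖ₑ ^ 2 < ⊤) → |∫ x, ⟪Literature.Analysis.FluidPDE.curl v x, fderiv ℝ v x (Literature.Analysis.FluidPDE.curl v x)⟫_ℝ| ≤ κ * M * Real.sqrt (∫ x, ‖Literature.Analysis.FluidPDE.curl v x‖ ^ 2) * Real.sqrt (∫ x, Literature.Analysis.FluidPDE.frobeniusNormSq (fderiv ℝ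 (Literature.Analysis.FluidPDE.curl v) x)))}) / 2) ^ 2 with hc₁
  have hc₁pos : 0 < c₁ := by rw [hc₁]; positivity
  refine ⟨c₁, max c₂ c₁, hc₁pos, le_max_right _ _, ?_⟩
  intro ε hε t₁ ht₁ hnull
  set m : ℝ := max ((sInf {κ : ℝ | (∀ (v : EuclideanSpace ℝ (Fin 3) → EuclideanSpace ℝ (Fin 3)) (M B : ℝ), ContDiff ℝ (⊤ : ℕ∞) v → Literature.Analysis.FluidPDE.VectorCalculus.IsDivFree v → (∀ x, ‖v x‖ ≤ M) → (∀ x, ‖fderiv ℝ v x‖ ≤ B) → (∫⁻ x, ‖iteratedFDeriv ℝ 0 v x‖ₑ ^ 2 < ⊤) → (∫⁻ x, ‖iteratedFDeriv ℝ 1 v x‖ₑ ^ 2 < ⊤) → (∫⁻ x, ‖iteratedFDeriv ℝ 2 v x‖ₑ ^ 2 < ⊤) → |∫ x, ⟪Literature.Analysis.FluidPDE.curl v x, fderiv ℝ v x (Literature.Analysis.FluidPDE.curl v x)⟫_ℝ| ≤ κ * M * Real.sqrt (∫ x, ‖Literature.Analysis.FluidPDE.curl v x‖ ^ 2) * Real.sqrt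 (∫ x, Literature.Analysis.FluidPDE.frobeniusNormSq (fderiv ℝ (Literature.Analysis.FluidPDE.curl v) x)))}) - ε) ((sInf {κ : ℝ | (∀ (v : EuclideanSpace ℝ (Fin 3) → EuclideanSpace ℝ (Fin 3)) (M B : ℝ), ContDiff ℝ (⊤ : ℕ∞) v → Literature.Analysis.FluidPDE.VectorCalculus.IsDivFree v → (∀ x, ‖v x‖ ≤ M) → (∀ x, ‖fderiv ℝ v x‖ ≤ B) → (∫⁻ x, ‖iteratedFDeriv ℝ 0 v x‖ₑ ^ 2 < ⊤) → (∫⁻ x, ‖iteratedFDeriv ℝ 1 v x‖ₑ ^ 2 < ⊤) → (∫⁻ x, ‖iteratedFDeriv ℝ 2 v x‖ₑ ^ 2 < ⊤) → |∫ x, ⟪Literature.Analysis.FluidPDE.curl v x, fderiv ℝ v x (Literature.Analysis.FluidPDE.curl v x)⟫_ℝ| ≤ κ * M * Real.sqrt (∫ x, ‖Literature.Analysis.FluidPDE.curl v x‖ ^ 2) * Real.sqrt (∫ x, Literature.Analysis.FluidPDE.frobeniusNormSq (fderiv ℝ (Literature.Analysis.FluidPDE.curl v) x)))}) / 2) wi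th hm
  have hmpos : 0 < m := lt_of_lt_of_le (by positivity) (le_max_right _ _)
  have hmlt : m < (sInf {κ : ℝ | (∀ (v : EuclideanSpace ℝ (Fin 3) → EuclideanSpace ℝ (Fin 3)) (M B : ℝ), ContDiff ℝ (⊤ : ℕ∞) v → Literature.Analysis.FluidPDE.VectorCalculus.IsDivFree v → (∀ x, ‖v x‖ ≤ M) → (∀ x, ‖fderiv ℝ v x‖ ≤ B) → (∫⁻ x, ‖iteratedFDeriv ℝ 0 v x‖ₑ ^ 2 < ⊤) → (∫⁻ x, ‖iteratedFDeriv ℝ 1 v x‖ₑ ^ 2 < ⊤) → (∫⁻ x, ‖iteratedFDeriv ℝ 2 v x‖ₑ ^ 2 < ⊤) → |∫ x, ⟪Literature.Analysis.FluidPDE.curl v x, fderiv ℝ v x (Literature.Analysis.FluidPDE.curl v x)⟫_ℝ| ≤ κ * M * Real.sqrt (∫ x, ‖Literature.Analysis.FluidPDE.curl v x‖ ^ 2) * Real.sqrt (∫ x, Literature.Analysis.FluidPDE.frobeniusNormSq (fderiv ℝ (Literature.Analysis.FluidPDE.curl v) x)))}) := max_lt (by linarith) (by linarith)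
  have hmge : (sInf {κ : ℝ | (∀ (v : EuclideanSpace ℝ (Fin 3) → EuclideanSpace ℝ (Fin 3)) (M B : ℝ), ContDiff ℝ (⊤ : ℕ∞) v → Literature.Analysis.FluidPDE.VectorCalculus.IsDivFree v → (∀ x, ‖v x‖ ≤ M) → (∀ x, ‖fderiv ℝ v x‖ ≤ B) → (∫⁻ x, ‖iteratedFDeriv ℝ 0 v x‖ₑ ^ 2 < ⊤) → (∫⁻ x, ‖iteratedFDeriv ℝ 1 v x‖ₑ ^ 2 < ⊤) → (∫⁻ x, ‖iteratedFDeriv ℝ 2 v x‖ₑ ^ 2 < ⊤) → |∫ x, ⟪Literature.Analysis.FluidPDE.curl v x, fderiv ℝ v x (Literature.Analysis.FluidPDE.curl v x)⟫_ℝ| ≤ κ * M * Real.sqrt (∫ x, ‖Literature.Analysis.FluidPDE.curl v x‖ ^ 2) * Real.sqrt (∫ x, Literature.Analysis.FluidPDE.frobeniusNormSq (fderiv ℝ (Literature.Analysis.FluidPDE.curl v) x)))}) - ε ≤ m := le_max_left _ _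
  have hm2 : (sInf {κ : ℝ | (∀ (v : EuclideanSpace ℝ (Fin 3) → EuclideanSpace ℝ (Fin 3)) (M B : ℝ), ContDiff ℝ (⊤ : ℕ∞) v → Literature.Analysis.FluidPDE.VectorCalculus.IsDivFree v → (∀ x, ‖v x‖ ≤ M) → (∀ x, ‖fderiv ℝ v x‖ ≤ B) → (∫⁻ x, ‖iteratedFDeriv ℝ 0 v x‖ₑ ^ 2 < ⊤) → (∫⁻ x, ‖iteratedFDeriv ℝ 1 v x‖ₑ ^ 2 < ⊤) → (∫⁻ x, ‖iteratedFDeriv ℝ 2 v x‖ₑ ^ 2 < ⊤) → |∫ x, ⟪Literature.Analysis.FluidPDE.curl v x, fderiv ℝ v x (Literature.Analysis.FluidPDE.curl v x)⟫_ℝ| ≤ κ * M * Real.sqrt (∫ x, ‖Literature.Analysis.FluidPDE.curl v x‖ ^ 2) * Real.sqrt (∫ x, Literature.Analysis.FluidPDE.frobeniusNormSq (fderiv ℝ (Literature.Analysis.FluidPDE.curl v) x)))}) / 2 ≤ m := le_max_right _ _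
  set t₁' : ℝ := max t₁ ((a + T) / 2) with ht₁'
  have ht₁'T : t₁' < T := max_lt ht₁.2 (by linarith [haT'])
  have ht₁'0 : 0 ≤ t₁' := ht₁.1.trans (le_max_left _ _)
  have ht₁t₁' : t₁ ≤ t₁' := le_max_left _ _
  have hat₁' : a < t₁' := lt_of_lt_of_le (by linarith [haT'] : a < (a + T) / 2) (le_max_right _ _)
  refine hup m hmpos hmlt t₁' ⟨ht₁'0, ht₁'T⟩ (measure_mono_null ?_ hnull)
  rintro t ⟨ht, ⟨M, hM, heff⟩, hZup⟩
  have htT : t ∈ Set.Ico 0 T := ⟨ht₁'0.trans ht.1, ht.2⟩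
  have hTt : 0 < T - t := sub_pos.2 ht.2
  have hsT : 0 < Real.sqrt (T - t) := Real.sqrt_pos.2 hTt
  -- slice data
  have hv : ContDiff ℝ (⊤ : ℕ∞) (u t) := hsol.contDiff_velocity htT
  have hv2 : ContDiff ℝ 2 (u t) := (hsol.contDiff_velocity htT).of_le (by norm_cast)
  have hdiv : Literature.Analysis.FluidPDE.VectorCalculus.IsDivFree (u t) := hsol.divFree _ htT
  have hB : ∀ x, ‖fderiv ℝ (u t) x‖ ≤ C₁ / (T - t) := fun x => by
    rw [le_div_iff₀ hTt, mul_comm]; exact hsub ⟨hat₁'.trans_le ht.1, ht.2⟩ x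
  have h0 := Summit.NavierStokesRegularity.NavierStokesRegularity.Theorems.EnstrophyBudget.sobolev_slice hloc htT 0
  have h1 := Summit.NavierStokesRegularity.NavierStokesRegularity.Theorems.EnstrophyBudget.sobolev_slice hloc htT 1
  have h2 := Summit.NavierStokesRegularity.NavierStokesRegularity.Theorems.EnstrophyBudget.sobolev_slice hloc htT 2
  set Zt : ℝ := (∫ x, ‖Literature.Analysis.FluidPDE.curl (u t) x‖ ^ 2) with hZt
  set Pt : ℝ := (∫ x, Literature.Analysis.FluidPDE.frobeniusNormSq (fderiv ℝ (Literature.Analysis.FluidPDE.curl (u t)) x)) with hPt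
  have hP0 : 0 ≤ Pt := integral_nonneg fun x => Literature.Analysis.FluidPDE.frobeniusNormSq_nonneg _
  have hM0 : 0 ≤ M := (norm_nonneg _).trans (hM 0)
  -- LOWER lock, unconditional: cap at level m ≥ κ⋆/2 with B = C₁/(T−t), Leray c₀²ν ≤ (T−t)M²
  have hcap : m ^ 2 * M ^ 2 * Pt ≤ (C₁ / (T - t)) ^ 2 * Zt :=
    Summit.NavierStokesRegularity.NavierStokesRegularity.Theorems.DepletionLadder.PerFlow.palinstrophy_le_of_efficient hv2 h1 hmpos hM hB heff
  obtain ⟨x₀, hx₀⟩ := hleray t htT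
  have hLM : c₀ * Real.sqrt ν ≤ Real.sqrt (T - t) * M := hx₀.trans (mul_le_mul_of_nonneg_left (hM x₀) hsT.le)
  have hLM2 : c₀ ^ 2 * ν ≤ (T - t) * M ^ 2 := by
    have h := pow_le_pow_left₀ (by positivity) hLM 2
    rw [mul_pow, mul_pow, Real.sq_sqrt hν.le, Real.sq_sqrt hTt.le] at h
    exact h
  have hlow : c₁ * (ν * (T - t)) * Pt ≤ Zt := by
    have key : c₀ ^ 2 * ((sInf {κ : ℝ | (∀ (v : EuclideanSpace ℝ (Fin 3) → EuclideanSpace ℝ (Fin 3)) (M B : ℝ), ContDiff ℝ (⊤ : ℕ∞) v → Literature.Analysis.FluidPDE.VectorCalculus.IsDivFree v → (∀ x, ‖v x‖ ≤ M) → (∀ x, ‖fderiv ℝ v x‖ ≤ B) → (∫⁻ x, ‖iteratedFDeriv ℝ 0 v x‖ₑ ^ 2 < ⊤) → (∫⁻ x, ‖iteratedFDeriv ℝ 1 v x‖ₑ ^ 2 < ⊤) → (∫⁻ x, ‖iteratedFDeriv ℝ 2 v x‖ₑ ^ 2 < ⊤) → |∫ x, ⟪Literature.Analysis.FluidPDE.curl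 v x, fderiv ℝ v x (Literature.Analysis.FluidPDE.curl v x)⟫_ℝ| ≤ κ * M * Real.sqrt (∫ x, ‖Literature.Analysis.FluidPDE.curl v x‖ ^ 2) * Real.sqrt (∫ x, Literature.Analysis.FluidPDE.frobeniusNormSq (fderiv ℝ (Literature.Analysis.FluidPDE.curl v) x)))}) / 2) ^ 2 * (ν * (T - t)) * Pt ≤ C₁ ^ 2 * Zt := by
      calc c₀ ^ 2 * ((sInf {κ : ℝ | (∀ (v : EuclideanSpace ℝ (Fin 3) → EuclideanSpace ℝ (Fin 3)) (M B : ℝ), ContDiff ℝ (⊤ : ℕ∞) v → Literature.Analysis.FluidPDE.VectorCalculus.IsDivFree v → (∀ x, ‖v x‖ ≤ M) → (∀ x, ‖fderiv ℝ v x‖ ≤ B) → (∫⁻ x, ‖iteratedFDeriv ℝ 0 v x‖ₑ ^ 2 < ⊤) → (∫⁻ x, ‖iteratedFDeriv ℝ 1 v x‖ₑ ^ 2 < ⊤) → (∫⁻ x, ‖iteratedFDeriv ℝ 2 v x‖ₑ ^ 2 < ⊤) → |∫ x, ⟪Literature.Analysis.FluidPDE.curl v x, fderiv ℝ v x (Literature.Analysis.FluidPDE.curl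 v x)⟫_ℝ| ≤ κ * M * Real.sqrt (∫ x, ‖Literature.Analysis.FluidPDE.curl v x‖ ^ 2) * Real.sqrt (∫ x, Literature.Analysis.FluidPDE.frobeniusNormSq (fderiv ℝ (Literature.Analysis.FluidPDE.curl v) x)))}) / 2) ^ 2 * (ν * (T - t)) * Pt = ((sInf {κ : ℝ | (∀ (v : EuclideanSpace ℝ (Fin 3) → EuclideanSpace ℝ (Fin 3)) (M B : ℝ), ContDiff ℝ (⊤ : ℕ∞) v → Literature.Analysis.FluidPDE.VectorCalculus.IsDivFree v → (∀ x, ‖v x‖ ≤ M) → (∀ x, ‖fderiv ℝ v x‖ ≤ B) → (∫⁻ x, ‖iteratedFDeriv ℝ 0 v x‖ₑ ^ 2 < ⊤) → (∫⁻ x, ‖iteratedFDeriv ℝ 1 v x‖ₑ ^ 2 < ⊤) → (∫⁻ x, ‖iteratedFDeriv ℝ 2 v x‖ₑ ^ 2 < ⊤) → |∫ x, ⟪Literature.Analysis.FluidPDE.curl v x, fderiv ℝ v x (Literature.Analysis.FluidPDE.curl v x)⟫_ℝ| ≤ κ * M * Real.sqrt (∫ x, ‖Literature.Analysis.FluidPDE.curl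 v x‖ ^ 2) * Real.sqrt (∫ x, Literature.Analysis.FluidPDE.frobeniusNormSq (fderiv ℝ (Literature.Analysis.FluidPDE.curl v) x)))}) / 2) ^ 2 * (c₀ ^ 2 * ν) * (T - t) * Pt := by ring
        _ ≤ m ^ 2 * ((T - t) * M ^ 2) * (T - t) * Pt := by
            apply mul_le_mul_of_nonneg_right _ hP0
            apply mul_le_mul_of_nonneg_right _ hTt.le
            exact mul_le_mul (pow_le_pow_left₀ (by positivity) hm2 2) hLM2 (by positivity) (by positivity)
        _ = (m ^ 2 * M ^ 2 * Pt) * (T - t) ^ 2 := by ring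
        _ ≤ ((C₁ / (T - t)) ^ 2 * Zt) * (T - t) ^ 2 := mul_le_mul_of_nonneg_right hcap (by positivity)
        _ = C₁ ^ 2 * Zt := by field_simp
    have hC₁2 : 0 < C₁ ^ 2 := by positivity
    calc c₁ * (ν * (T - t)) * Pt = (c₀ ^ 2 * ((sInf {κ : ℝ | (∀ (v : EuclideanSpace ℝ (Fin 3) → EuclideanSpace ℝ (Fin 3)) (M B : ℝ), ContDiff ℝ (⊤ : ℕ∞) v → Literature.Analysis.FluidPDE.VectorCalculus.IsDivFree v → (∀ x, ‖v x‖ ≤ M) → (∀ x, ‖fderiv ℝ v x‖ ≤ B) → (∫⁻ x, ‖iteratedFDeriv ℝ 0 v x‖ₑ ^ 2 < ⊤) → (∫⁻ x, ‖iteratedFDeriv ℝ 1 v x‖ₑ ^ 2 < ⊤) → (∫⁻ x, ‖iteratedFDeriv ℝ 2 v x‖ₑ ^ 2 < ⊤) → |∫ x, ⟪Literature.Analysis.FluidPDE.curl v x, fderiv ℝ v x (Literature.Analysis.FluidPDE.curl v x)⟫_ℝ| ≤ κ * M * Real.sqrt (∫ x, ‖Literature.Analysis.FluidPDE.curl v x‖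 ^ 2) * Real.sqrt (∫ x, Literature.Analysis.FluidPDE.frobeniusNormSq (fderiv ℝ (Literature.Analysis.FluidPDE.curl v) x)))}) / 2) ^ 2 * (ν * (T - t)) * Pt) / C₁ ^ 2 := by rw [hc₁]; ring
      _ ≤ (C₁ ^ 2 * Zt) / C₁ ^ 2 := div_le_div_of_nonneg_right key hC₁2.le
      _ = Zt := by field_simp
  -- UPPER lock from the stub, weakened to max c₂ c₁
  have hupp : Zt ≤ max c₂ c₁ * (ν * (T - t)) * Pt :=
    hZup.trans (mul_le_mul_of_nonneg_right (mul_le_mul_of_nonneg_right (le_max_left _ _) (by positivity)) hP0)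
  refine ⟨⟨ht₁t₁'.trans ht.1, ht.2⟩, hlow, hupp, ?_⟩
  -- the `(κ⋆ − ε)`-efficiency clause
  set D : ℝ := M * Real.sqrt (∫ x, ‖Literature.Analysis.FluidPDE.curl (u t) x‖ ^ 2) * Real.sqrt (∫ x, Literature.Analysis.FluidPDE.frobeniusNormSq (fderiv ℝ (Literature.Analysis.FluidPDE.curl (u t)) x)) with hD
  have hD0 : 0 ≤ D := by rw [hD]; positivity
  have heff' : m * D < |∫ x, ⟪Literature.Analysis.FluidPDE.curl (u t) x, fderiv ℝ (u t) x (Literature.Analysis.FluidPDE.curl (u t) x)⟫_ℝ| := by rw [hD]; simpa only [mul_assoc] using heff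
  have huniv : |∫ x, ⟪Literature.Analysis.FluidPDE.curl (u t) x, fderiv ℝ (u t) x (Literature.Analysis.FluidPDE.curl (u t) x)⟫_ℝ| ≤ (sInf {κ : ℝ | (∀ (v : EuclideanSpace ℝ (Fin 3) → EuclideanSpace ℝ (Fin 3)) (M B : ℝ), ContDiff ℝ (⊤ : ℕ∞) v → Literature.Analysis.FluidPDE.VectorCalculus.IsDivFree v → (∀ x, ‖v x‖ ≤ M) → (∀ x, ‖fderiv ℝ v x‖ ≤ B) → (∫⁻ x, ‖iteratedFDeriv ℝ 0 v x‖ₑ ^ 2 < ⊤) → (∫⁻ x, ‖iteratedFDeriv ℝ 1 v x‖ₑ ^ 2 < ⊤) → (∫⁻ x, ‖iteratedFDeriv ℝ 2 v x‖ₑ ^ 2 < ⊤) → |∫ x, ⟪Literature.Analysis.FluidPDE.curl v x, fderiv ℝ v x (Literature.Analysis.FluidPDE.curl v x)⟫_ℝ| ≤ κ * M * Real.sqrt (∫ x, ‖Literature.Analysis.FluidPDE.curl v x‖ ^ 2) * Real.sqrt (∫ x, Literature.Analysis.FluidPDE.frobeniusNormSq (fderiv ℝ (Literature.Analysis.FluidPDE.curl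 v) x)))}) * M * Real.sqrt (∫ x, ‖Literature.Analysis.FluidPDE.curl (u t) x‖ ^ 2) * Real.sqrt (∫ x, Literature.Analysis.FluidPDE.frobeniusNormSq (fderiv ℝ (Literature.Analysis.FluidPDE.curl (u t)) x)) :=
    Summit.NavierStokesRegularity.NavierStokesRegularity.Theorems.DepletionLadder.sharpDepletion_is_universal (u t) M (C₁ / (T - t)) hv hdiv hM hB h0 h1 h2
  have hDpos : 0 < D := by
    rcases hD0.lt_or_eq with h | h
    · exact h
    · exfalso
      have hJ0 : |∫ x, ⟪Literature.Analysis.FluidPDE.curl (u t) x, fderiv ℝ (u t) x (Literature.Analysis.FluidPDE.curl (u t) x)⟫_ℝ| ≤ 0 := by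
        calc |∫ x, ⟪Literature.Analysis.FluidPDE.curl (u t) x, fderiv ℝ (u t) x (Literature.Analysis.FluidPDE.curl (u t) x)⟫_ℝ| ≤ (sInf {κ : ℝ | (∀ (v : EuclideanSpace ℝ (Fin 3) → EuclideanSpace ℝ (Fin 3)) (M B : ℝ), ContDiff ℝ (⊤ : ℕ∞) v → Literature.Analysis.FluidPDE.VectorCalculus.IsDivFree v → (∀ x, ‖v x‖ ≤ M) → (∀ x, ‖fderiv ℝ v x‖ ≤ B) → (∫⁻ x, ‖iteratedFDeriv ℝ 0 v x‖ₑ ^ 2 < ⊤) → (∫⁻ x, ‖iteratedFDeriv ℝ 1 v x‖ₑ ^ 2 < ⊤) → (∫⁻ x, ‖iteratedFDeriv ℝ 2 v x‖ₑ ^ 2 < ⊤) → |∫ x, ⟪Literature.Analysis.FluidPDE.curl v x, fderiv ℝ v x (Literature.Analysis.FluidPDE.curl v x)⟫_ℝ| ≤ κ * M * Real.sqrt (∫ x, ‖Literature.Analysis.FluidPDE.curl v x‖ ^ 2) * Real.sqrt (∫ x, Literature.Analysis.FluidPDE.frobeniusNormSq (fderiv ℝ (Literature.Analysis.FluidPDE.curl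 v) x)))}) * M * Real.sqrt (∫ x, ‖Literature.Analysis.FluidPDE.curl (u t) x‖ ^ 2) * Real.sqrt (∫ x, Literature.Analysis.FluidPDE.frobeniusNormSq (fderiv ℝ (Literature.Analysis.FluidPDE.curl (u t)) x)) := huniv
          _ = (sInf {κ : ℝ | (∀ (v : EuclideanSpace ℝ (Fin 3) → EuclideanSpace ℝ (Fin 3)) (M B : ℝ), ContDiff ℝ (⊤ : ℕ∞) v → Literature.Analysis.FluidPDE.VectorCalculus.IsDivFree v → (∀ x, ‖v x‖ ≤ M) → (∀ x, ‖fderiv ℝ v x‖ ≤ B) → (∫⁻ x, ‖iteratedFDeriv ℝ 0 v x‖ₑ ^ 2 < ⊤) → (∫⁻ x, ‖iteratedFDeriv ℝ 1 v x‖ₑ ^ 2 < ⊤) → (∫⁻ x, ‖iteratedFDeriv ℝ 2 v x‖ₑ ^ 2 < ⊤) → |∫ x, ⟪Literature.Analysis.FluidPDE.curl v x, fderiv ℝ v x (Literature.Analysis.FluidPDE.curl v x)⟫_ℝ| ≤ κ * M * Real.sqrt (∫ x, ‖Literature.Analysis.FluidPDE.curl v x‖ ^ 2) * Real.sqrt (∫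 x, Literature.Analysis.FluidPDE.frobeniusNormSq (fderiv ℝ (Literature.Analysis.FluidPDE.curl v) x)))}) * D := by rw [hD]; ring
          _ = 0 := by rw [← h]; ring
      have : m * D < 0 := lt_of_lt_of_le heff' hJ0
      rw [← h] at this; simp at this
  refine ⟨hv, hdiv, ⟨C₁ / (T - t), hB⟩, h1, h2, M, hM, by simpa only [hD, mul_assoc] using hDpos, ?_⟩
  have hmge0 : ((sInf {κ : ℝ | (∀ (v : EuclideanSpace ℝ (Fin 3) → EuclideanSpace ℝ (Fin 3)) (M B : ℝ), ContDiff ℝ (⊤ : ℕ∞) v → Literature.Analysis.FluidPDE.VectorCalculus.IsDivFree v → (∀ x, ‖v x‖ ≤ M) → (∀ x, ‖fderiv ℝ v x‖ ≤ B) → (∫⁻ x, ‖iteratedFDeriv ℝ 0 v x‖ₑ ^ 2 < ⊤) → (∫⁻ x, ‖iteratedFDeriv ℝ 1 v x‖ₑ ^ 2 < ⊤) → (∫⁻ x, ‖iteratedFDeriv ℝ 2 v x‖ₑ ^ 2 < ⊤) → |∫ x, ⟪Literature.Analysis.FluidPDE.curl v x, fderiv ℝ v x (Literature.Analysis.FluidPDE.curl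 v x)⟫_ℝ| ≤ κ * M * Real.sqrt (∫ x, ‖Literature.Analysis.FluidPDE.curl v x‖ ^ 2) * Real.sqrt (∫ x, Literature.Analysis.FluidPDE.frobeniusNormSq (fderiv ℝ (Literature.Analysis.FluidPDE.curl v) x)))}) - ε) * D ≤ m * D := mul_le_mul_of_nonneg_right hmge hD0
  have : ((sInf {κ : ℝ | (∀ (v : EuclideanSpace ℝ (Fin 3) → EuclideanSpace ℝ (Fin 3)) (M B : ℝ), ContDiff ℝ (⊤ : ℕ∞) v → Literature.Analysis.FluidPDE.VectorCalculus.IsDivFree v → (∀ x, ‖v x‖ ≤ M) → (∀ x, ‖fderiv ℝ v x‖ ≤ B) → (∫⁻ x, ‖iteratedFDeriv ℝ 0 v x‖ₑ ^ 2 < ⊤) → (∫⁻ x, ‖iteratedFDeriv ℝ 1 v x‖ₑ ^ 2 < ⊤) → (∫⁻ x, ‖iteratedFDeriv ℝ 2 v x‖ₑ ^ 2 < ⊤) → |∫ x, ⟪Literature.Analysis.FluidPDE.curl v x, fderiv ℝ v x (Literature.Analysis.FluidPDE.curl v x)⟫_ℝ| ≤ κ * M * Real.sqrt (∫ x, ‖Literature.Analysis.FluidPDE.curl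 v x‖ ^ 2) * Real.sqrt (∫ x, Literature.Analysis.FluidPDE.frobeniusNormSq (fderiv ℝ (Literature.Analysis.FluidPDE.curl v) x)))}) - ε) * D ≤ |∫ x, ⟪Literature.Analysis.FluidPDE.curl (u t) x, fderiv ℝ (u t) x (Literature.Analysis.FluidPDE.curl (u t) x)⟫_ℝ| := hmge0.trans heff'.le
  simpa only [hD, mul_assoc] using this

end Summit.NavierStokesRegularity.NavierStokesRegularity.Theorems.DepletionLadder.PerFlow

end
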